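import Summits.CriticalPhenomena.PercolationContinuityZ3.Theorems.PercNearOneGluingNoHeavyLowerTailSahiClassTSingleCubeLambdaTwo
import Summits.CriticalPhenomena.PercolationContinuityZ3.Theorems.PercNearOneGluingNoHeavyLowerTailSahiTwoLevelBernsteinBridge
import Summits.CriticalPhenomena.PercolationContinuityZ3.Theorems.PercNearOneGluingNoHeavyLowerTailSahiCombMixCoord
import Mathlib.Tactic.Linarith
import Mathlib.Tactic.Ring
import HarnessLib

/-!
# `NoHeavyLowerTail` (crux stmt-CriticalPhenomena-4575), P2 — class T on a single cube, III: **the λ = 2 forms MC1, MC2 (bnk-2's two-level laws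
# `SahiTwoLevelMinus` / `SahiTwoLevelPlus` at the sections) and master-conj's BGC hold at EVERY coordinate of every class-T triple of events**

Support file (seat `prim-masterthm-p2`, gen 14; `--supports stmt-CriticalPhenomena-4575`).  No definition, no `sorry`, standard axioms.

THE GENERAL BRIDGE (any triple, any coordinate).  For events `A, B, C ⊆ 2^κ`, a product measure `μ_p` and a coordinate `e`, write `E(s) = E_3(μ_{p[e↦s]}; 1_A,1_B,1_C)`
(the fibre cubic, Bernstein coefficients `B₀ = E(0)`, `B₁, B₂`, `B₃ = E(1)`).  By P2's one-coordinate decomposition (`SahiCoordinateBernstein.sahiE_three_decomp_coord`)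
  `E(s) − s²E(1) − (1−s)²E(0) = s(1−s)·[(1−s)·MC1(e) + s·MC2(e)]`,   `MC1 = 3B₁ − B₀ = b₁ + B₀ + B₃`,  `MC2 = 3B₂ − B₃ = b₂ + B₀ + B₃`
(`b_i = coordPiece_i`), so **`E(s) ≥ s²E(1) + (1−s)²E(0)` for all `s ∈ [0,1]` ⟺ `MC1(e) ≥ 0 ∧ MC2(e) ≥ 0`** — the λ = 2 rung at `e` in the value form used by
`…SahiClassTLambdaTwo*` IS bnk-2's pair of two-level laws at the section pair `(U^{e←1}, U^{e←0})` (`SahiTwoLevel.coordPiece₁_add_eq_twoLevelForm`,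
`coordPiece₂_add_eq_twoLevelPlus`), in general.

* `mc_nonneg_of_forall_sq_mul_le` — the direction `⟹` of the bridge (elementary: an affine function nonnegative on `(0,1)` is nonnegative at the ends).
* **`coordPiece_add_nonneg_of_classT`** — for increasing `U₀, U₁, U₂` with no coordinate essential to all three (`SahiHybrid.IsClassT`), every `p`, every `e`:
  `0 ≤ coordPiece₁ p e ![U₀,U₁,U₂] + E_3(U⁰) + E_3(U¹)` (MC1) and `0 ≤ coordPiece₂ p e ![U₀,U₁,U₂] + E_3(U⁰) + E_3(U¹)` (MC2).
* **`twoLevelForm_secAt_nonneg_of_classT`**, **`twoLevelPlus_secAt_nonneg_of_classT`** — the same in bnk-2's vocabulary: `SahiTwoLevelMinus` and `SahiTwoLevelPlus` HOLD at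
  the section pair of every coordinate of every class-T triple (third proved class of the two-level laws, beside `κ₃(G) ≥ 0` (bnk-2 g9) and independent tops (bnk-2 g16)).
* `bernstein_mid_nonneg_of_classT` — BGC on class T in piece form: `3B₁(e) = MC1 + B₀ ≥ 0` and `3B₂(e) = MC2 + B₃ ≥ 0` (sections are class T, so `B₀, B₃ ≥ 0`).
* `mixC1_eq_twoLevelForm_add`, `mixC2_eq_twoLevelPlus_add` — master-conj's mixed coefficients (`SahiCombMix.mixC1/mixC2`, file `…SahiCombMixCoord`; `= 3B₁, 3B₂`)
  are `T(G,H) + E_3(H)` and `T(G,H) − ∏δ + E_3(G)` (ring identities, any weight) — the dictionary between the three vocabularies (P2 pieces / bnk-2 / master-conj).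
* **`mixC_nonneg_of_classT`** — in master-conj's vocabulary (`SahiMasterFamilyBernsteinGoodCoordinate`): for `U : Fin 3 → Set (Set κ)` increasing and class T,
  EVERY coordinate is Bernstein-good: `0 ≤ mixC1 (bernoulliWeight p) (U^{e←0}) (U^{e←1}) ∧ 0 ≤ mixC2 …` — BGC-all is a THEOREM on class T.
* `masterFamilyNonneg_three_iff_triplyEssential` — Kahn's Conjecture 5 ⟺ its restriction to triples with a coordinate essential to all three members.
HONEST FRAMING: off class T (triples with a coordinate essential to all three members) the two-level laws / BGC-all / `C_3` remain OPEN; the core reductions in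
bnk-2's vocabulary are in `…SahiClassTCoreTwoLevel`. [this work]
-/

noncomputable section

open scoped Classical

namespace Summit.CriticalPhenomena.PercolationContinuityZ3.Theorems

namespace SahiClassTCube

open Finset Function
open Literature.Combinatorics.Sahi2008
open Literature.Probability.LatticeModels (prodBernoulli)
open Literature.Probability.Percolation (DeterminedBy)
open Literature.Probability.Percolation.DecisionTree (ind ind_of_mem ind_of_not_mem ind_nonneg)
open SahiCoordinateBernstein (coordPiece₁ coordPiece₂ sahiE_three_decomp_coord)

variable {κ : Type} [Fintype κ]

/-! ### The general bridge: `E(s) ≥ s²E(1) + (1−s)²E(0)` on `[0,1]` forces `MC1, MC2 ≥ 0` -/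

/-- An affine function `(1−s)·a + s·b` that is nonnegative after multiplication by `s(1−s)` for every `s ∈ [0,1]` has `a, b ≥ 0`. [folklore] -/
theorem affine_nonneg_of_forall_unitInterval {a b : ℝ} (h : ∀ s : unitInterval, 0 ≤ (s : ℝ) * (1 - (s : ℝ)) * ((1 - (s : ℝ)) * a + (s : ℝ) * b)) :
    0 ≤ a ∧ 0 ≤ b := by
  have key : ∀ {a b : ℝ}, (∀ s : ℝ, 0 ≤ s → s ≤ 1 → 0 ≤ s * (1 - s) * ((1 - s) * a + s * b)) → 0 ≤ a := by
    intro a b h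
    by_contra ha
    have ha' : a < 0 := lt_of_not_ge ha
    by_cases hb : b ≤ 0
    · have h1 := h (1 / 2) (by norm_num) (by norm_num)
      nlinarith
    · have hb' : 0 < b := lt_of_not_ge hb
      have hd : 0 < b - a := by linarith
      set s : ℝ := -a / (2 * (b - a)) with hs
      have hs0 : 0 < s := by rw [hs]; exact div_pos (by linarith) (by linarith)
      have hs1 : s ≤ 1 / 2 := by
        rw [hs, div_le_iff₀ (by linarith)]; nlinarith
      have hL : (1 - s) * a + s * b = a / 2 := by
        have e1 : (1 - s) * a + s * b = a + s * (b - a) := by ring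
        rw [e1, hs]; field_simp; ring
      have h2 := h s hs0.le (by linarith)
      rw [hL] at h2
      have h3 : 0 < s * (1 - s) := mul_pos hs0 (by linarith)
      nlinarith
  refine ⟨key (fun s hs0 hs1 => h ⟨s, hs0, hs1⟩), key (b := a) (fun s hs0 hs1 => ?_)⟩
  have h' := h ⟨1 - s, by linarith, by linarith⟩
  have e1 : ((⟨1 - s, by linarith, by linarith⟩ : unitInterval) : ℝ) = 1 - s := rfl
  rw [e1] at h'
  have e2 : (1 - s) * (1 - (1 - s)) * ((1 - (1 - s)) * a + (1 - s) * b) = s * (1 - s) * ((1 - s) * b + s * a) := by ring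
  linarith [e2 ▸ h']

/-- **The bridge, direction `⟹`**: if `s²·E_3(μ_{p[e↦1]}) + (1−s)²·E_3(μ_{p[e↦0]}) ≤ E_3(μ_{p[e↦s]})` for every `s ∈ [0,1]`, then
`MC1(e) = b₁ + B₀ + B₃ ≥ 0` and `MC2(e) = b₂ + B₀ + B₃ ≥ 0` (`b_i = coordPiece_i`, `B₀, B₃` = `E_3` of the sections). [this work] -/
theorem mc_nonneg_of_forall_sq_mul_le (p : κ → unitInterval) (e : κ) (A B C : Set (Set κ))
    (h : ∀ s : unitInterval,
      (s : ℝ) ^ 2 * sahiE (bernoulliWeight (update p e 1)) 3 ![ind A, ind B, ind C] +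
        (1 - (s : ℝ)) ^ 2 * sahiE (bernoulliWeight (update p e 0)) 3 ![ind A, ind B, ind C] ≤
        sahiE (bernoulliWeight (update p e s)) 3 ![ind A, ind B, ind C]) :
    0 ≤ coordPiece₁ p e ![A, B, C]
        + sahiE (bernoulliWeight p) 3 ![ind (secAt e false A), ind (secAt e false B), ind (secAt e false C)]
        + sahiE (bernoulliWeight p) 3 ![ind (secAt e true A), ind (secAt e true B), ind (secAt e true C)] ∧
      0 ≤ coordPiece₂ p e ![A, B, C]
        + sahiE (bernoulliWeight p) 3 ![ind (secAt e false A), ind (secAt e false B), ind (secAt e false C)]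
        + sahiE (bernoulliWeight p) 3 ![ind (secAt e true A), ind (secAt e true B), ind (secAt e true C)] := by
  -- names
  set E0 := sahiE (bernoulliWeight p) 3 ![ind (secAt e false A), ind (secAt e false B), ind (secAt e false C)] with hE0
  set E1 := sahiE (bernoulliWeight p) 3 ![ind (secAt e true A), ind (secAt e true B), ind (secAt e true C)] with hE1
  have hU : (fun j => ind ((![A, B, C] : Fin 3 → Set (Set κ)) j)) = ![ind A, ind B, ind C] := by
    funext j; fin_cases j <;> rfl
  have hsec : ∀ b : Bool, (fun j => ind (secAt e b ((![A, B, C] : Fin 3 → Set (Set κ)) j))) =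
      ![ind (secAt e b A), ind (secAt e b B), ind (secAt e b C)] := by
    intro b; funext j; fin_cases j <;> rfl
  -- the sections under `μ_{p[e↦s]}` are the sections under `μ_p`
  have hsecS : ∀ (s : unitInterval) (b : Bool),
      sahiE (bernoulliWeight (update p e s)) 3 (fun j => ind (secAt e b ((![A, B, C] : Fin 3 → Set (Set κ)) j))) =
        sahiE (bernoulliWeight p) 3 (fun j => ind (secAt e b ((![A, B, C] : Fin 3 → Set (Set κ)) j))) := by
    intro s b
    rw [sahiE_secAt_update_eq p e b s (p e), update_eq_self]
  -- the endpoint values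
  have hend : ∀ b : Bool, sahiE (bernoulliWeight (update p e (boolParam b))) 3 ![ind A, ind B, ind C] =
      sahiE (bernoulliWeight p) 3 ![ind (secAt e b A), ind (secAt e b B), ind (secAt e b C)] := by
    intro b
    rw [← hU, sahiE_update_boolParam_eq_secAt, hsecS, hsec]
  have hb1 : ((boolParam true : unitInterval)) = 1 := by simp [boolParam]
  have hb0 : ((boolParam false : unitInterval)) = 0 := by simp [boolParam]
  have hend1 : sahiE (bernoulliWeight (update p e 1)) 3 ![ind A, ind B, ind C] = E1 := by rw [← hb1, hend true]
  have hend0 : sahiE (bernoulliWeight (update p e 0)) 3 ![ind A, ind B, ind C] = E0 := by rw [← hb0, hend false]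
  -- the decomposition along `e` at the parameter `p[e↦s]`
  have hdec : ∀ s : unitInterval, sahiE (bernoulliWeight (update p e s)) 3 ![ind A, ind B, ind C] =
      (1 - (s : ℝ)) * E0 + (s : ℝ) * E1 +
        (s : ℝ) * (1 - (s : ℝ)) * ((1 - (s : ℝ)) * coordPiece₁ p e ![A, B, C] + (s : ℝ) * coordPiece₂ p e ![A, B, C]) := by
    intro s
    have h3 := sahiE_three_decomp_coord (update p e s) e ![A, B, C]
    rw [hU, update_self, hsecS, hsecS, hsec, hsec, SahiCoordinateChord.coordPiece₁_update_same,
      SahiCoordinateChord.coordPiece₂_update_same] at h3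
    exact h3
  refine affine_nonneg_of_forall_unitInterval fun s => ?_
  have hs := h s
  rw [hend1, hend0, hdec s] at hs
  nlinarith [hs]

/-! ### Class T: MC1, MC2, BGC at every coordinate -/

section ClassT

variable {U₀ U₁ U₂ : Set (Set κ)}

/-- **MC1 and MC2 at every coordinate of a class-T triple**: `0 ≤ b₁(e) + B₀ + B₃` and `0 ≤ b₂(e) + B₀ + B₃`. [this work] -/
theorem coordPiece_add_nonneg_of_classT (hU₀ : IsUpperSet U₀) (hU₁ : IsUpperSet U₁) (hU₂ : IsUpperSet U₂)
    (hT : ∀ x, ¬ (x ∈ esupp U₀ ∧ x ∈ esupp U₁ ∧ x ∈ esupp U₂)) (p : κ → unitInterval) (e : κ) :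
    0 ≤ coordPiece₁ p e ![U₀, U₁, U₂]
        + sahiE (bernoulliWeight p) 3 ![ind (secAt e false U₀), ind (secAt e false U₁), ind (secAt e false U₂)]
        + sahiE (bernoulliWeight p) 3 ![ind (secAt e true U₀), ind (secAt e true U₁), ind (secAt e true U₂)] ∧
      0 ≤ coordPiece₂ p e ![U₀, U₁, U₂]
        + sahiE (bernoulliWeight p) 3 ![ind (secAt e false U₀), ind (secAt e false U₁), ind (secAt e false U₂)]
        + sahiE (bernoulliWeight p) 3 ![ind (secAt e true U₀), ind (secAt e true U₁), ind (secAt e true U₂)] := by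
  refine mc_nonneg_of_forall_sq_mul_le p e U₀ U₁ U₂ fun s => ?_
  have h := sq_mul_sahiE_three_add_le_of_classT hU₀ hU₁ hU₂ hT (update p e s) e
  rw [update_idem, update_idem, update_self] at h
  exact h

/-- **`SahiTwoLevelMinus` at the sections of a class-T triple** (bnk-2's bottom two-level law `T(U¹,U⁰) ≥ 0`, i.e. `3B₁ ≥ B₀`). [this work] -/
theorem twoLevelForm_secAt_nonneg_of_classT (hU₀ : IsUpperSet U₀) (hU₁ : IsUpperSet U₁) (hU₂ : IsUpperSet U₂)
    (hT : ∀ x, ¬ (x ∈ esupp U₀ ∧ x ∈ esupp U₁ ∧ x ∈ esupp U₂)) (p : κ → unitInterval) (e : κ) :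
    0 ≤ twoLevelForm (fun X => (prodBernoulli p).real X) ![secAt e true U₀, secAt e true U₁, secAt e true U₂]
        ![secAt e false U₀, secAt e false U₁, secAt e false U₂] := by
  have h := (coordPiece_add_nonneg_of_classT hU₀ hU₁ hU₂ hT p e).1
  rw [SahiTwoLevel.coordPiece₁_add_eq_twoLevelForm] at h
  simpa only [ex_bernoulliWeight_ind] using h

/-- **`SahiTwoLevelPlus` at the sections of a class-T triple** (bnk-2's top two-level law `T(U¹,U⁰) − ∏δ ≥ 0`, i.e. `3B₂ ≥ B₃`). [this work] -/
theorem twoLevelPlus_secAt_nonneg_of_classT (hU₀ : IsUpperSet U₀) (hU₁ : IsUpperSet U₁) (hU₂ : IsUpperSet U₂)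
    (hT : ∀ x, ¬ (x ∈ esupp U₀ ∧ x ∈ esupp U₁ ∧ x ∈ esupp U₂)) (p : κ → unitInterval) (e : κ) :
    0 ≤ twoLevelForm (fun X => (prodBernoulli p).real X) ![secAt e true U₀, secAt e true U₁, secAt e true U₂]
          ![secAt e false U₀, secAt e false U₁, secAt e false U₂]
        - ∏ i : Fin 3, ((prodBernoulli p).real ((![secAt e true U₀, secAt e true U₁, secAt e true U₂] : Fin 3 → Set (Set κ)) i)
            - (prodBernoulli p).real ((![secAt e false U₀, secAt e false U₁, secAt e false U₂] : Fin 3 → Set (Set κ)) i)) := by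
  have h := (coordPiece_add_nonneg_of_classT hU₀ hU₁ hU₂ hT p e).2
  rw [SahiTwoLevel.coordPiece₂_add_eq_twoLevelPlus] at h
  simpa only [ex_bernoulliWeight_ind] using h

/-- **BGC on class T**: the two middle Bernstein coefficients of the fibre cubic are nonnegative at every coordinate,
`3B₁(e) = MC1(e) + B₀ ≥ 0` and `3B₂(e) = MC2(e) + B₃ ≥ 0` (in piece form: `0 ≤ b₁ + 2B₀ + B₃`, `0 ≤ b₂ + B₀ + 2B₃`). [this work] -/
theorem bernstein_mid_nonneg_of_classT (hU₀ : IsUpperSet U₀) (hU₁ : IsUpperSet U₁) (hU₂ : IsUpperSet U₂)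
    (hT : ∀ x, ¬ (x ∈ esupp U₀ ∧ x ∈ esupp U₁ ∧ x ∈ esupp U₂)) (p : κ → unitInterval) (e : κ) :
    0 ≤ coordPiece₁ p e ![U₀, U₁, U₂]
        + 2 * sahiE (bernoulliWeight p) 3 ![ind (secAt e false U₀), ind (secAt e false U₁), ind (secAt e false U₂)]
        + sahiE (bernoulliWeight p) 3 ![ind (secAt e true U₀), ind (secAt e true U₁), ind (secAt e true U₂)] ∧
      0 ≤ coordPiece₂ p e ![U₀, U₁, U₂]
        + sahiE (bernoulliWeight p) 3 ![ind (secAt e false U₀), ind (secAt e false U₁), ind (secAt e false U₂)]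
        + 2 * sahiE (bernoulliWeight p) 3 ![ind (secAt e true U₀), ind (secAt e true U₁), ind (secAt e true U₂)] := by
  have h := coordPiece_add_nonneg_of_classT hU₀ hU₁ hU₂ hT p e
  -- the sections are class T again, so `B₀, B₃ ≥ 0`
  have hsub : ∀ (b : Bool) (x : κ), ¬ (x ∈ esupp (secAt e b U₀) ∧ x ∈ esupp (secAt e b U₁) ∧ x ∈ esupp (secAt e b U₂)) := by
    rintro b x ⟨h0, h1, h2⟩
    exact hT x ⟨Finset.mem_of_subset (Finset.erase_subset _ _) (esupp_secAt_subset hU₀ e b h0),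
      Finset.mem_of_subset (Finset.erase_subset _ _) (esupp_secAt_subset hU₁ e b h1),
      Finset.mem_of_subset (Finset.erase_subset _ _) (esupp_secAt_subset hU₂ e b h2)⟩
  have h0 := sahiE_three_nonneg_of_classT (isUpperSet_secAt e false hU₀) (isUpperSet_secAt e false hU₁)
    (isUpperSet_secAt e false hU₂) (hsub false) p
  have h1 := sahiE_three_nonneg_of_classT (isUpperSet_secAt e true hU₀) (isUpperSet_secAt e true hU₁)
    (isUpperSet_secAt e true hU₂) (hsub true) p
  constructor <;> linarith [h.1, h.2]

/-! ### master-conj's vocabulary: every coordinate of a class-T triple is BERNSTEIN-GOOD (`mixC1, mixC2 ≥ 0`) -/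

/-- `mixC1 = 3B₁ = T(G,H) + E_3(H)`: master-conj's first mixed coefficient is bnk-2's two-level form plus `E_3` of the bottom triple (any weight). [this work] -/
theorem mixC1_eq_twoLevelForm_add (μ : Set κ → ℝ) (H G : Fin 3 → Set (Set κ)) :
    SahiCombMix.mixC1 μ H G = twoLevelForm (fun X => ex μ (ind X)) G H + sahiE μ 3 (fun j => ind (H j)) := by
  rw [SahiCombMix.mixC1, twoLevelForm, sahiE_three_apply]
  simp only [SahiTwoLevel.ind_mul_ind]
  ring

/-- `mixC2 = 3B₂ = T(G,H) − ∏δ + E_3(G)`: master-conj's second mixed coefficient is bnk-2's TOP form plus `E_3` of the top triple (any weight). [this work] -/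
theorem mixC2_eq_twoLevelPlus_add (μ : Set κ → ℝ) (H G : Fin 3 → Set (Set κ)) :
    SahiCombMix.mixC2 μ H G = twoLevelForm (fun X => ex μ (ind X)) G H - ∏ i : Fin 3, (ex μ (ind (G i)) - ex μ (ind (H i)))
      + sahiE μ 3 (fun j => ind (G j)) := by
  rw [SahiCombMix.mixC2, twoLevelForm, sahiE_three_apply, Fin.prod_univ_three]
  simp only [SahiTwoLevel.ind_mul_ind]
  ring

/-- **EVERY COORDINATE OF A CLASS-T TRIPLE IS BERNSTEIN-GOOD** (master-conj's BGC, `SahiMasterFamilyBernsteinGoodCoordinate`): for increasing `U` with no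
coordinate essential to all three members, every `p` and every `e`, both mixed one-coordinate Bernstein coefficients `mixC1_e, mixC2_e` (`= 3B₁(e), 3B₂(e)`) of
`E_3(μ_p; 1_U)` are `≥ 0`.  (So BGC-all — "every triple has all coordinates Bernstein-good" — is a THEOREM on class T; its open core is the class of
triples with a triply-essential coordinate.) [this work] -/
theorem mixC_nonneg_of_classT (U : Fin 3 → Set (Set κ)) (hU : ∀ j, IsUpperSet (U j))
    (hT : ∀ x, ¬ (x ∈ esupp (U 0) ∧ x ∈ esupp (U 1) ∧ x ∈ esupp (U 2))) (p : κ → unitInterval) (e : κ) :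
    0 ≤ SahiCombMix.mixC1 (bernoulliWeight p) (fun j => secAt e false (U j)) (fun j => secAt e true (U j)) ∧
      0 ≤ SahiCombMix.mixC2 (bernoulliWeight p) (fun j => secAt e false (U j)) (fun j => secAt e true (U j)) := by
  have h := coordPiece_add_nonneg_of_classT (hU 0) (hU 1) (hU 2) hT p e
  rw [SahiTwoLevel.coordPiece₁_add_eq_twoLevelForm, SahiTwoLevel.coordPiece₂_add_eq_twoLevelPlus] at h
  -- the sections are class T again, so their `E_3`'s are `≥ 0`
  have hsub : ∀ (b : Bool) (x : κ), ¬ (x ∈ esupp (secAt e b (U 0)) ∧ x ∈ esupp (secAt e b (U 1)) ∧ x ∈ esupp (secAt e b (U 2))) := by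
    rintro b x ⟨h0, h1, h2⟩
    exact hT x ⟨Finset.mem_of_subset (Finset.erase_subset _ _) (esupp_secAt_subset (hU 0) e b h0),
      Finset.mem_of_subset (Finset.erase_subset _ _) (esupp_secAt_subset (hU 1) e b h1),
      Finset.mem_of_subset (Finset.erase_subset _ _) (esupp_secAt_subset (hU 2) e b h2)⟩
  have h0 := sahiE_three_nonneg_of_classT' (fun j => secAt e false (U j)) (fun j => isUpperSet_secAt e false (hU j)) (hsub false) p
  have h1 := sahiE_three_nonneg_of_classT' (fun j => secAt e true (U j)) (fun j => isUpperSet_secAt e true (hU j)) (hsub true) p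
  rw [mixC1_eq_twoLevelForm_add, mixC2_eq_twoLevelPlus_add, Fin.prod_univ_three]
  rw [Fin.prod_univ_three] at h
  have eT : twoLevelForm (fun X => ex (bernoulliWeight p) (ind X)) (fun j => secAt e true (U j)) (fun j => secAt e false (U j)) =
      twoLevelForm (fun X => ex (bernoulliWeight p) (ind X)) ![secAt e true (U 0), secAt e true (U 1), secAt e true (U 2)]
        ![secAt e false (U 0), secAt e false (U 1), secAt e false (U 2)] := rfl
  rw [eT]
  simp only [Matrix.cons_val_zero, Matrix.cons_val_one, Matrix.cons_val] at h ⊢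
  constructor <;> linarith [h.1, h.2]

/-! ### The frontier: Kahn's Conjecture 5 reduces to triples with a coordinate essential to all three members -/

/-- **THE FRONTIER AFTER CLASS T.**  Kahn's Conjecture 5 / Sahi's `C_3` on product measures (`MasterFamilyNonneg 3`, ⟺ `KahnConjecture` by
`masterFamilyNonneg_three_iff_kahnConjecture`) is EQUIVALENT to its restriction to triples of increasing events having a coordinate essential to all three
members (the complement of class T, where `sahiE_three_nonneg_of_classT` settles it).  With canalyzing peeling (`…SahiCoordinateCanalyzingPeel`) the open
core is further cut down to mixed-core such triples (paper, SAHI-ROUTE §4.34(d)). [this work] -/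
theorem masterFamilyNonneg_three_iff_triplyEssential :
    MasterFamilyNonneg 3 ↔
      ∀ (κ : Type) [Fintype κ] (p : κ → unitInterval) (U : Fin 3 → Set (Set κ)), (∀ j, IsUpperSet (U j)) →
        (∃ x, x ∈ esupp (U 0) ∧ x ∈ esupp (U 1) ∧ x ∈ esupp (U 2)) → 0 ≤ sahiE (bernoulliWeight p) 3 (fun j => ind (U j)) := by
  constructor
  · intro h κ _ p U hU _
    exact h κ p U hU
  · intro h κ _ p U hU
    by_cases hT : ∃ x, x ∈ esupp (U 0) ∧ x ∈ esupp (U 1) ∧ x ∈ esupp (U 2)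
    · exact h κ p U hU hT
    · push Not at hT
      exact sahiE_three_nonneg_of_classT' U hU (fun x hx => hT x hx.1 hx.2.1 hx.2.2) p

end ClassT


end SahiClassTCube

end Summit.CriticalPhenomena.PercolationContinuityZ3.Theorems
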